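import Literature.Probability.RandomPlanarGeometry.HexSAWStripWidthTwoContactChernoff
import HarnessLib

/-!
# The width-two strip: spectral decomposition of the TILTED transfer matrix `G(y)` along the Perron curve `c(y, λ) = 0` —
# `G(y)^k = (λ^k/d)·Π̃ + N^k` with explicit rank-one `Π̃ = u ⊗ w`, `N³ + pN² + κN = 0`, and a geometric bound on `N^k`
# (module «WIDTH-TWO TILTED SPECTRAL DECOMPOSITION»; brick 2 of the contact CLT programme)

Topic `Literature/Probability/RandomPlanarGeometry` (continues «WIDTH-TWO CONTACT CHERNOFF BOUNDS» — `W2.perronCubicTwo`, `W2.yOfLam`, `W2.uLam`,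
`W2.gTwo_mulVec_uLam` — and generalises «WIDTH-TWO HAT CONVERGENCE» (`W2.projTwo`, `W2.nilTwo_cubic`, `W2.pTwo`, `W2.kTwo`, `W2.rTwo`: the case
`y = y₂`, `λ = 1`) to every point of the Perron curve; uses the lane tool `Literature.Analysis.abs_le_of_rec_two` / `quadRootBound`
(`LinearRecurrenceDeflation`, a-p5)).  Lane «pcv-sawmu» (CriticalPhenomena venture), a-p2 g27.  Setting: E. Seneta, *Non-negative matrices* (1973) §1.4
(Perron root, left/right eigenvectors, the rank-one projection); R. P. Stanley, EC1 (2012) §4.1 Theorem 4.1.1 (rational generating functions: the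
subdominant poles give geometric corrections); W. Feller I (1968) XIII.6, XIII.10.  Purpose: the moment generating function of the surface-contact count of
a bridge of hat index `k` at the tilted fugacity `y` is `D̂(k; y)_{ab}/D̂(k; y₂)_{ab}` with `D̂(k; y) = G(y)^k·P`; this file makes its growth `λ(y)^k` EXACT
with an explicit prefactor and a geometrically small remainder, at every tilt, by polynomial identities on the curve (no eigenvalue perturbation theory).
Nothing below is printed.

## What is proved (namespace `…SAW.HV.W2`; `x = x_c`; throughout `hc : perronCubicTwo y λ = 0`)

§1 ★ `wLam λ = (0, x²λ, x⁵, λ(λ − x²))` with `wLam_vecMul_gTwo` (`w·G(y) = λ·w`); `dLam y λ = w·u = λ⁴ − 2x²λ³ + x⁴λ² + 2x⁶yλ − x⁸y` (`dLam_eq`);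
`projNumLam = u ⊗ w` with `projNumLam_mul_self` (`Π̃² = dΠ̃`), `gTwo_mul_projNumLam` / `projNumLam_mul_gTwo` (`GΠ̃ = Π̃G = λΠ̃`); `pLam = λ − x²(1+y)`,
`kLam = λ² − x²(1+y)λ + x⁴y` with `kLam_mul_lam` (`κλ = x⁶y`); `gTwoSq`, `gTwoCube` (explicit `G²`, `G³`); ★★ `spectral_identity_Lam` —
`d·(G³ + pG² + κG) = (λ³ + pλ² + κλ)·Π̃` (the spectral-projector formula, sixteen certificates modulo `c(y, λ)` and `2x⁴ − 4x² + 1`);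
`nilNumLam = d·G − λ·Π̃` with `nilNumLam_mul_projNumLam` (`MΠ̃ = Π̃M = 0`), `nilNumLam_sq`, `nilNumLam_cube`, ★★ `nilNumLam_cubic`
(`λM³ + λpd·M² + x⁶yd²·M = 0`).
§2 `nilNumLam_pow_mul_projNumLam`, ★ `dLam_smul_gTwo_pow` (`(dG)^k = M^k + λ^k d^{k−1}Π̃`), `nilLam = M/d`, `nilLam_pow`, ★★ `gTwo_pow_eq_Lam`
(`G^k = (λ^k/d)·Π̃ + N^k`, `d ≠ 0`), ★ `nilLam_cubic` (`N³ + pN² + κN = 0`, `d, λ ≠ 0`), `nil_seq_rec_Lam` (order-two recurrence of `(N^{n+1}X)_{ab}`),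
`rateLam = quadRootBound(p, κ)`, ★★ `nilLam_pow_mul_abs_le` (`|(N^{n+2}X)_{ab}| ≤ R^{n+1}|c₀| + (n+1)Rⁿ(|c₁| + R|c₀|)`), and
★★★ **`hatD_two_eq_Lam`**: for every `y ≥ 0` on the curve with `d ≠ 0` and `k ≥ 1`, `D̂(k; y) = (λ^k/d)·(Π̃·P) + N^k·P`.
§3 Consistency at criticality: `pLam_kLam_crit` (`p(y₂,1) = pTwo`, `κ(y₂,1) = kTwo`, `rateLam y₂ 1 = rTwo`), `dLam_crit` (`d(y₂,1) = 5/7 − 2x²/7 > 0`),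
★ `projNumLam_crit` (`Π̃(y₂,1) = d(y₂,1)·projTwo`).

Label: LANE THEOREM (own result of lane «pcv-sawmu», a-p2 g27, 2026-08-28; not in print).  NOT claimed (next bricks): uniformity of the bound in `λ`
near `1` (continuity of `rateLam`, `dLam`, `c₀`, `c₁`), the inverse `λ(s)` of `s = log(y(λ)/y₂)`, the limit `k·log λ(t/√k) − φ₃t√k → σ̂t²/2`, and the
CLT via Curtiss' theorem (`Literature.Probability.Moments.tendsto_gaussianReal_of_tendsto_mgf`).
-/

noncomputable section

open Finset Filter Topology Matrix Literature.Probability.LatticeModels Literature.Probability.Percolation Literature.Analysis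

namespace Literature.Probability.RandomPlanarGeometry.SAW

namespace HV

namespace W2

/-! ## §1 The left eigenvector, the Perron projection and the deflated part on the Perron curve `c(y, λ) = 0` -/

/-- ★ The explicit left eigenvector `w(λ) = (0, x²λ, x⁵, λ(λ − x²))` of `G(y)` (for the eigenvalue `λ`, when `c(y, λ) = 0`).
[cite: Seneta1973, §1.4; lane «pcv-sawmu» a-p2 g27 — own] -/
def wLam (lam : ℝ) : Fin (2 * 2) → ℝ :=
  ![0, hexCriticalFugacity ^ 2 * lam, hexCriticalFugacity ^ 5, lam * (lam - hexCriticalFugacity ^ 2)]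

/-- `w(λ)·G(y) = λ·w(λ)` when `c(y, λ) = 0` (columns `0–2` identically, column `3` is the cubic). [cite: Seneta1973, §1.4; lane «pcv-sawmu» a-p2 g27] -/
theorem wLam_vecMul_gTwo {y lam : ℝ} (hc : perronCubicTwo y lam = 0) : wLam lam ᵥ* gTwo y = lam • wLam lam := by
  rw [perronCubicTwo] at hc
  set x := hexCriticalFugacity with hx
  ext a
  fin_cases a <;> simp [gTwo, wLam, Matrix.vecMul, dotProduct, Fin.sum_univ_four, ← hx]
    <;> first
      | linear_combination
      | linear_combination ((-1 : ℝ)) * hc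

/-- The normalisation `d(y, λ) = w·u = λ⁴ − 2x²λ³ + x⁴λ² + 2x⁶yλ − x⁸y`. [cite: Seneta1973, §1.4; lane «pcv-sawmu» a-p2 g27] -/
def dLam (y lam : ℝ) : ℝ := (1 : ℝ) * lam ^ 4 + (-2 : ℝ) * hexCriticalFugacity ^ 2 * lam ^ 3 + (1 : ℝ) * hexCriticalFugacity ^ 4 * lam ^ 2 + (2 : ℝ) * hexCriticalFugacity ^ 6 * y * lam + (-1 : ℝ) * hexCriticalFugacity ^ 8 * y

/-- `d = w ⬝ᵥ u`. [cite: Seneta1973, §1.4; lane plumbing] -/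
theorem dLam_eq (y lam : ℝ) : dLam y lam = wLam lam ⬝ᵥ uLam y lam := by
  simp [dLam, wLam, uLam, dotProduct, Fin.sum_univ_four]
  ring

/-- The unnormalised Perron projection `Π̃ = u ⊗ w` (`Π = Π̃/d`). [cite: Seneta1973, §1.4; lane «pcv-sawmu» a-p2 g27] -/
def projNumLam (y lam : ℝ) : Matrix (Fin (2 * 2)) (Fin (2 * 2)) ℝ := Matrix.vecMulVec (uLam y lam) (wLam lam)

/-- `Π̃·Π̃ = d·Π̃`. [cite: Seneta1973, §1.4; lane plumbing] -/
theorem projNumLam_mul_self (y lam : ℝ) : projNumLam y lam * projNumLam y lam = dLam y lam • projNumLam y lam := by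
  ext a b
  fin_cases a <;> fin_cases b <;> simp [projNumLam, Matrix.vecMulVec, Matrix.mul_apply, Fin.sum_univ_four, dLam, uLam, wLam, Matrix.smul_apply]
    <;> ring

/-- `G·Π̃ = λ·Π̃` on the Perron curve. [cite: Seneta1973, §1.4; lane «pcv-sawmu» a-p2 g27] -/
theorem gTwo_mul_projNumLam {y lam : ℝ} (hc : perronCubicTwo y lam = 0) : gTwo y * projNumLam y lam = lam • projNumLam y lam := by
  rw [perronCubicTwo] at hc
  set x := hexCriticalFugacity with hx
  ext a b
  fin_cases a <;> fin_cases b <;> simp [gTwo, projNumLam, Matrix.vecMulVec, uLam, wLam, Matrix.mul_apply, Fin.sum_univ_four, ← hx]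
    <;> first
      | linear_combination
      | linear_combination ((-1 : ℝ) * x ^ 5) * hc
      | linear_combination ((-1 : ℝ) * x ^ 2 * lam) * hc
      | linear_combination ((-1 : ℝ) * lam ^ 2 + (1 : ℝ) * x ^ 2 * lam) * hc

/-- `Π̃·G = λ·Π̃` on the Perron curve. [cite: Seneta1973, §1.4; lane «pcv-sawmu» a-p2 g27] -/
theorem projNumLam_mul_gTwo {y lam : ℝ} (hc : perronCubicTwo y lam = 0) : projNumLam y lam * gTwo y = lam • projNumLam y lam := by
  rw [perronCubicTwo] at hc
  set x := hexCriticalFugacity with hx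
  ext a b
  fin_cases a <;> fin_cases b <;> simp [gTwo, projNumLam, Matrix.vecMulVec, uLam, wLam, Matrix.mul_apply, Fin.sum_univ_four, ← hx]
    <;> first
      | linear_combination
      | linear_combination ((-1 : ℝ) * x ^ 3 * y) * hc
      | linear_combination ((-1 : ℝ) * x ^ 4 * y) * hc
      | linear_combination ((-1 : ℝ) * lam ^ 2 + (1 : ℝ) * x ^ 2 * lam) * hc
      | linear_combination ((-1 : ℝ) * x * y * lam + (1 : ℝ) * x ^ 3 * y) * hc

/-- The subdominant coefficients on the Perron curve: `p = λ − x²(1+y)`; with `κ = λ² − x²(1+y)λ + x⁴y` one has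
`c(y, μ) = (μ − λ)(μ² + pμ + κ) + (κλ − x⁶y)` and `κλ = x⁶y` on the curve. [cite: Stanley2012EC1, §4.1; lane «pcv-sawmu» a-p2 g27] -/
def pLam (y lam : ℝ) : ℝ := lam - hexCriticalFugacity ^ 2 * (1 + y)

/-- `κ(y, λ) = λ² − x²(1+y)λ + x⁴y`. [cite: Stanley2012EC1, §4.1; lane «pcv-sawmu» a-p2 g27] -/
def kLam (y lam : ℝ) : ℝ := lam ^ 2 - hexCriticalFugacity ^ 2 * (1 + y) * lam + hexCriticalFugacity ^ 4 * y

/-- `κ·λ = x⁶y` on the Perron curve. [cite: Stanley2012EC1, §4.1; lane plumbing] -/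
theorem kLam_mul_lam {y lam : ℝ} (hc : perronCubicTwo y lam = 0) : kLam y lam * lam = hexCriticalFugacity ^ 6 * y := by
  rw [perronCubicTwo] at hc
  rw [kLam]
  linear_combination hc

/-- `G(y)²` written out. [cite: Stanley2012EC1, §4.1; lane plumbing] -/
def gTwoSq (y : ℝ) : Matrix (Fin (2 * 2)) (Fin (2 * 2)) ℝ :=
  Matrix.of ![![0, (1 : ℝ) * hexCriticalFugacity ^ 3, (1 : ℝ) * hexCriticalFugacity ^ 4, (1 : ℝ) * hexCriticalFugacity ^ 3 * y],
    ![0, (1 : ℝ) * hexCriticalFugacity ^ 4, (1 : ℝ) * hexCriticalFugacity ^ 5, (1 : ℝ) * hexCriticalFugacity ^ 4 * y],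
    ![0, (1 : ℝ) * hexCriticalFugacity ^ 3 * y, 0, (1 : ℝ) * hexCriticalFugacity ^ 3 * y ^ 2],
    ![0, (1 : ℝ) * hexCriticalFugacity ^ 4 + (1 : ℝ) * hexCriticalFugacity ^ 4 * y, (1 : ℝ) * hexCriticalFugacity ^ 5, (1 : ℝ) * hexCriticalFugacity ^ 4 * y ^ 2]]

/-- `G(y)³` written out. [cite: Stanley2012EC1, §4.1; lane plumbing] -/
def gTwoCube (y : ℝ) : Matrix (Fin (2 * 2)) (Fin (2 * 2)) ℝ :=
  Matrix.of ![![0, (1 : ℝ) * hexCriticalFugacity ^ 5 + (1 : ℝ) * hexCriticalFugacity ^ 5 * y, (1 : ℝ) * hexCriticalFugacity ^ 6, (1 : ℝ) * hexCriticalFugacity ^ 5 * y + (1 : ℝ) * hexCriticalFugacity ^ 5 * y ^ 2],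
    ![0, (1 : ℝ) * hexCriticalFugacity ^ 6 + (1 : ℝ) * hexCriticalFugacity ^ 6 * y, (1 : ℝ) * hexCriticalFugacity ^ 7, (1 : ℝ) * hexCriticalFugacity ^ 6 * y + (1 : ℝ) * hexCriticalFugacity ^ 6 * y ^ 2],
    ![0, (1 : ℝ) * hexCriticalFugacity ^ 5 * y + (1 : ℝ) * hexCriticalFugacity ^ 5 * y ^ 2, (1 : ℝ) * hexCriticalFugacity ^ 6 * y, (1 : ℝ) * hexCriticalFugacity ^ 5 * y ^ 3],
    ![0, (1 : ℝ) * hexCriticalFugacity ^ 6 + (1 : ℝ) * hexCriticalFugacity ^ 6 * y + (1 : ℝ) * hexCriticalFugacity ^ 6 * y ^ 2, (1 : ℝ) * hexCriticalFugacity ^ 7 + (1 : ℝ) * hexCriticalFugacity ^ 7 * y, (1 : ℝ) * hexCriticalFugacity ^ 6 * y + (1 : ℝ) * hexCriticalFugacity ^ 6 * y ^ 3]]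

/-- `G·G = gTwoSq`. [cite: Stanley2012EC1, §4.1; lane plumbing] -/
theorem gTwo_mul_gTwo (y : ℝ) : gTwo y * gTwo y = gTwoSq y := by
  ext a b
  fin_cases a <;> fin_cases b <;> simp [gTwo, gTwoSq, Matrix.mul_apply, Fin.sum_univ_four] <;> ring

/-- `G²·G = gTwoCube`. [cite: Stanley2012EC1, §4.1; lane plumbing] -/
theorem gTwoSq_mul_gTwo (y : ℝ) : gTwoSq y * gTwo y = gTwoCube y := by
  ext a b
  fin_cases a <;> fin_cases b <;> simp [gTwo, gTwoSq, gTwoCube, Matrix.mul_apply, Fin.sum_univ_four] <;> ring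

/-- ★★ **The spectral-projector identity on the Perron curve**: `d·(G³ + pG² + κG) = (λ³ + pλ² + κλ)·Π̃` — `G(G² + pG + κ)` kills the eigenvalues
`0, σ, σ̄` and acts as `λ(λ² + pλ + κ)` on the Perron line (sixteen polynomial identities modulo `c(y, λ) = 0` and `2x⁴ − 4x² + 1 = 0`).
[cite: Seneta1973, §1.4 (the Perron projection); Stanley2012EC1, §4.1 Theorem 4.1.1 (iii); lane «pcv-sawmu» a-p2 g27 — own computation] -/
theorem spectral_identity_Lam {y lam : ℝ} (hc : perronCubicTwo y lam = 0) :
    dLam y lam • (gTwoCube y + pLam y lam • gTwoSq y + kLam y lam • gTwo y)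
      = (lam ^ 3 + pLam y lam * lam ^ 2 + kLam y lam * lam) • projNumLam y lam := by
  rw [perronCubicTwo] at hc
  have hP := xc_minpoly
  set x := hexCriticalFugacity with hx
  ext a b
  fin_cases a <;> fin_cases b <;>
    simp [gTwo, gTwoSq, gTwoCube, pLam, kLam, dLam, projNumLam, Matrix.vecMulVec, uLam, wLam, Matrix.smul_apply, ← hx]
    <;> first
      | linear_combination
      | linear_combination ((-2 : ℝ) * x ^ 6 * y * lam + (1 : ℝ) * x ^ 8 * y) * hc
      | linear_combination ((-2 : ℝ) * x ^ 5 * lam ^ 2 + (1 : ℝ) * x ^ 7 * lam) * hc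
      | linear_combination ((-2 : ℝ) * x ^ 2 * lam ^ 3 + (1 : ℝ) * x ^ 4 * lam ^ 2) * hc
      | linear_combination ((1 : ℝ) * x ^ 2 * lam ^ 3 + (-1 : ℝ) * x ^ 4 * lam ^ 2) * hc
      | linear_combination ((1 : ℝ) * x ^ 3 * lam ^ 3 + (-1 : ℝ) * x ^ 5 * lam ^ 2) * hc
      | linear_combination ((-2 : ℝ) * x ^ 3 * y * lam ^ 2 + (1 : ℝ) * x ^ 5 * y * lam) * hc
      | linear_combination ((-2 : ℝ) * x ^ 4 * y * lam ^ 2 + (1 : ℝ) * x ^ 6 * y * lam) * hc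
      | linear_combination ((-2 : ℝ) * x * y * lam ^ 3 + (3 : ℝ) * x ^ 3 * y * lam ^ 2 + (-1 : ℝ) * x ^ 5 * y * lam) * hc
      | linear_combination ((1 : ℝ) * x * lam ^ 3 + (-1 : ℝ) * x ^ 3 * lam ^ 2 + (-2 : ℝ) * x ^ 5 * y * lam + (1 : ℝ) * x ^ 7 * y) * hc
      | linear_combination ((1 : ℝ) * x ^ 2 * lam ^ 3 + (-1 : ℝ) * x ^ 4 * lam ^ 2 + (-2 : ℝ) * x ^ 6 * y * lam + (1 : ℝ) * x ^ 8 * y) * hc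
      | linear_combination ((-3 : ℝ) * lam ^ 4 + (5 : ℝ) * x ^ 2 * lam ^ 3 + (-2 : ℝ) * x ^ 4 * lam ^ 2 + (-2 : ℝ) * x ^ 6 * y * lam + (1 : ℝ) * x ^ 8 * y) * hc

/-- ★ The scaled deflated part `M = d·G − λ·Π̃` (`= d·N`, `N = G − λΠ` the part of `G` off the Perron line). [cite: Stanley2012EC1, §4.1; lane «pcv-sawmu» a-p2 g27] -/
def nilNumLam (y lam : ℝ) : Matrix (Fin (2 * 2)) (Fin (2 * 2)) ℝ := dLam y lam • gTwo y - lam • projNumLam y lam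

/-- `M·Π̃ = 0` and `Π̃·M = 0` on the Perron curve. [cite: Seneta1973, §1.4; lane plumbing] -/
theorem nilNumLam_mul_projNumLam {y lam : ℝ} (hc : perronCubicTwo y lam = 0) :
    nilNumLam y lam * projNumLam y lam = 0 ∧ projNumLam y lam * nilNumLam y lam = 0 := by
  rw [nilNumLam, Matrix.sub_mul, Matrix.mul_sub, Matrix.smul_mul, Matrix.mul_smul, Matrix.smul_mul, Matrix.mul_smul,
    gTwo_mul_projNumLam hc, projNumLam_mul_gTwo hc, projNumLam_mul_self, smul_smul, smul_smul, mul_comm (dLam y lam) lam, sub_self]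
  exact ⟨rfl, rfl⟩

/-- `M² = d²·G² − dλ²·Π̃` on the Perron curve. [cite: Stanley2012EC1, §4.1; lane plumbing] -/
theorem nilNumLam_sq {y lam : ℝ} (hc : perronCubicTwo y lam = 0) :
    nilNumLam y lam * nilNumLam y lam = dLam y lam ^ 2 • gTwoSq y - (dLam y lam * lam ^ 2) • projNumLam y lam := by
  have h1 := gTwo_mul_projNumLam hc
  have h2 := projNumLam_mul_gTwo hc
  have h3 := projNumLam_mul_self y lam
  rw [nilNumLam, Matrix.sub_mul, Matrix.mul_sub, Matrix.mul_sub, Matrix.smul_mul, Matrix.mul_smul, Matrix.smul_mul, Matrix.mul_smul,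
    Matrix.smul_mul, Matrix.mul_smul, Matrix.smul_mul, Matrix.mul_smul, h1, h2, h3, gTwo_mul_gTwo]
  ext a b
  simp only [Matrix.sub_apply, Matrix.smul_apply, smul_eq_mul]
  ring

/-- `M³ = d³·G³ − d²λ³·Π̃` on the Perron curve. [cite: Stanley2012EC1, §4.1; lane plumbing] -/
theorem nilNumLam_cube {y lam : ℝ} (hc : perronCubicTwo y lam = 0) :
    nilNumLam y lam * nilNumLam y lam * nilNumLam y lam = dLam y lam ^ 3 • gTwoCube y - (dLam y lam ^ 2 * lam ^ 3) • projNumLam y lam := by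
  have h1 := gTwo_mul_projNumLam hc
  have h2 := projNumLam_mul_gTwo hc
  have h3 := projNumLam_mul_self y lam
  have hG2P : gTwoSq y * projNumLam y lam = lam ^ 2 • projNumLam y lam := by
    rw [← gTwo_mul_gTwo, Matrix.mul_assoc, h1, Matrix.mul_smul, h1, smul_smul, pow_two]
  rw [nilNumLam_sq hc, nilNumLam, Matrix.sub_mul, Matrix.mul_sub, Matrix.mul_sub, Matrix.smul_mul, Matrix.mul_smul, Matrix.smul_mul,
    Matrix.mul_smul, Matrix.smul_mul, Matrix.mul_smul, Matrix.smul_mul, Matrix.mul_smul, gTwoSq_mul_gTwo, hG2P, h2, h3]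
  ext a b
  simp only [Matrix.sub_apply, Matrix.smul_apply, smul_eq_mul]
  ring

/-- ★★ **The deflated part is annihilated by `μ(μ² + pμ + κ)`** (scaled form, no division): on the Perron curve
`λ·M³ + (λ·p·d)·M² + (x⁶y·d²)·M = 0` (from `M^j = d^jG^j − d^{j−1}λ^jΠ̃`, `x⁶y = κλ` and the spectral-projector identity).
[cite: Stanley2012EC1, §4.1 Theorem 4.1.1 (iii); Seneta1973, §1.4; lane «pcv-sawmu» a-p2 g27 — own] -/
theorem nilNumLam_cubic {y lam : ℝ} (hc : perronCubicTwo y lam = 0) :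
    lam • (nilNumLam y lam * nilNumLam y lam * nilNumLam y lam) + (lam * pLam y lam * dLam y lam) • (nilNumLam y lam * nilNumLam y lam)
      + (hexCriticalFugacity ^ 6 * y * dLam y lam ^ 2) • nilNumLam y lam = 0 := by
  have hk := kLam_mul_lam hc
  have hspec := spectral_identity_Lam hc
  rw [nilNumLam_cube hc, nilNumLam_sq hc, nilNumLam, ← hk]
  -- both sides are scalar combinations of `G³, G², G, Π̃`
  have e : lam • (dLam y lam ^ 3 • gTwoCube y - (dLam y lam ^ 2 * lam ^ 3) • projNumLam y lam)
      + (lam * pLam y lam * dLam y lam) • (dLam y lam ^ 2 • gTwoSq y - (dLam y lam * lam ^ 2) • projNumLam y lam)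
      + (kLam y lam * lam * dLam y lam ^ 2) • (dLam y lam • gTwo y - lam • projNumLam y lam)
      = (lam * dLam y lam ^ 2) • (dLam y lam • (gTwoCube y + pLam y lam • gTwoSq y + kLam y lam • gTwo y)
        - (lam ^ 3 + pLam y lam * lam ^ 2 + kLam y lam * lam) • projNumLam y lam) := by
    ext a b
    simp only [Matrix.add_apply, Matrix.sub_apply, Matrix.smul_apply, smul_eq_mul]
    ring
  rw [e, hspec, sub_self, smul_zero]

/-! ## §2 Powers of `G(y)` on the Perron curve: `D̂(k; y) = (λ^k/d)·Π̃·P + N^k·P` with `N` geometrically small -/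

/-- `M^k·Π̃ = 0` for `k ≥ 1` on the Perron curve. [cite: Seneta1973, §1.4; lane plumbing] -/
theorem nilNumLam_pow_mul_projNumLam {y lam : ℝ} (hc : perronCubicTwo y lam = 0) (k : ℕ) :
    nilNumLam y lam ^ (k + 1) * projNumLam y lam = 0 := by
  rw [pow_succ, Matrix.mul_assoc, (nilNumLam_mul_projNumLam hc).1, Matrix.mul_zero]

/-- ★ `(d·G)^k = M^k + λ^k d^{k−1}·Π̃` for `k ≥ 1` (cross terms vanish: `MΠ̃ = Π̃M = 0`, `Π̃² = dΠ̃`). [cite: Stanley2012EC1, §4.1; lane «pcv-sawmu» a-p2 g27] -/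
theorem dLam_smul_gTwo_pow {y lam : ℝ} (hc : perronCubicTwo y lam = 0) (k : ℕ) :
    (dLam y lam • gTwo y) ^ (k + 1) = nilNumLam y lam ^ (k + 1) + (lam ^ (k + 1) * dLam y lam ^ k) • projNumLam y lam := by
  induction k with
  | zero =>
    rw [zero_add, pow_one, pow_one, pow_one, pow_zero, mul_one, nilNumLam, sub_add_cancel]
  | succ k ih =>
    rw [pow_succ, ih, Matrix.add_mul]
    have e : dLam y lam • gTwo y = nilNumLam y lam + lam • projNumLam y lam := by rw [nilNumLam, sub_add_cancel]
    rw [e, Matrix.mul_add, Matrix.mul_add, Matrix.smul_mul, Matrix.smul_mul, Matrix.mul_smul, Matrix.mul_smul,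
      nilNumLam_pow_mul_projNumLam hc, (nilNumLam_mul_projNumLam hc).2, projNumLam_mul_self, smul_zero, smul_zero, add_zero, zero_add,
      ← pow_succ, smul_smul, smul_smul]
    congr 1
    ext a b
    simp only [Matrix.smul_apply, smul_eq_mul]
    ring

/-- The normalised deflated part `N = M/d = G − (λ/d)·Π̃`. [cite: Seneta1973, §1.4; lane «pcv-sawmu» a-p2 g27] -/
def nilLam (y lam : ℝ) : Matrix (Fin (2 * 2)) (Fin (2 * 2)) ℝ := (dLam y lam)⁻¹ • nilNumLam y lam

/-- `N^k = d^{−k}·M^k`. [cite: Seneta1973, §1.4; lane plumbing] -/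
theorem nilLam_pow (y lam : ℝ) (k : ℕ) : nilLam y lam ^ k = (dLam y lam)⁻¹ ^ k • nilNumLam y lam ^ k := by
  rw [nilLam, smul_pow]

/-- ★★ **Spectral decomposition of the powers of the tilted transfer matrix**: on the Perron curve with `d ≠ 0`, for every `k ≥ 1`,
`G(y)^k = (λ^k/d)·Π̃ + N^k`. [cite: Seneta1973, §1.4 (Perron projection); Stanley2012EC1, §4.1 Theorem 4.1.1; lane «pcv-sawmu» a-p2 g27 — own] -/
theorem gTwo_pow_eq_Lam {y lam : ℝ} (hc : perronCubicTwo y lam = 0) (hd : dLam y lam ≠ 0) (k : ℕ) :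
    gTwo y ^ (k + 1) = (lam ^ (k + 1) / dLam y lam) • projNumLam y lam + nilLam y lam ^ (k + 1) := by
  have h := dLam_smul_gTwo_pow hc k
  rw [smul_pow] at h
  have hdk : dLam y lam ^ (k + 1) ≠ 0 := pow_ne_zero _ hd
  have h2 : gTwo y ^ (k + 1) = (dLam y lam ^ (k + 1))⁻¹ • (nilNumLam y lam ^ (k + 1) + (lam ^ (k + 1) * dLam y lam ^ k) • projNumLam y lam) := by
    rw [← h, smul_smul, inv_mul_cancel₀ hdk, one_smul]
  rw [h2, nilLam_pow, smul_add, smul_smul, inv_pow, add_comm]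
  congr 1
  congr 1
  rw [pow_succ]
  field_simp

/-- ★ **The cubic relation of the normalised deflated part**: `N³ + p·N² + κ·N = 0` on the Perron curve (`d ≠ 0`, `λ ≠ 0`).
[cite: Stanley2012EC1, §4.1 Theorem 4.1.1 (iii); lane «pcv-sawmu» a-p2 g27 — own] -/
theorem nilLam_cubic {y lam : ℝ} (hc : perronCubicTwo y lam = 0) (hd : dLam y lam ≠ 0) (hlam : lam ≠ 0) :
    nilLam y lam ^ 3 + pLam y lam • nilLam y lam ^ 2 + kLam y lam • nilLam y lam = 0 := by
  have h := nilNumLam_cubic hc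
  have hk := kLam_mul_lam hc
  rw [← hk] at h
  -- divide the scaled identity by `λ·d³`
  have h3 : nilLam y lam ^ 3 = (dLam y lam)⁻¹ ^ 3 • (nilNumLam y lam * nilNumLam y lam * nilNumLam y lam) := by
    rw [nilLam_pow, show nilNumLam y lam ^ 3 = nilNumLam y lam * nilNumLam y lam * nilNumLam y lam by rw [pow_succ, pow_two]]
  have h2 : nilLam y lam ^ 2 = (dLam y lam)⁻¹ ^ 2 • (nilNumLam y lam * nilNumLam y lam) := by
    rw [nilLam_pow, show nilNumLam y lam ^ 2 = nilNumLam y lam * nilNumLam y lam by rw [pow_two]]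
  have h1 : nilLam y lam = (dLam y lam)⁻¹ • nilNumLam y lam := rfl
  have key : nilLam y lam ^ 3 + pLam y lam • nilLam y lam ^ 2 + kLam y lam • nilLam y lam
      = (lam⁻¹ * (dLam y lam)⁻¹ ^ 3) • (lam • (nilNumLam y lam * nilNumLam y lam * nilNumLam y lam)
        + (lam * pLam y lam * dLam y lam) • (nilNumLam y lam * nilNumLam y lam)
        + (kLam y lam * lam * dLam y lam ^ 2) • nilNumLam y lam) := by
    rw [h3, h2, h1]
    ext a b
    simp only [Matrix.add_apply, Matrix.smul_apply, smul_eq_mul]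
    field_simp
  rw [key, h, smul_zero]

/-- The order-two recurrence of the sequences `n ↦ (N^{n+1}·X)_{ab}` for ANY right factor `X` (from `N³ + pN² + κN = 0`).
[cite: Stanley2012EC1, §4.1 Theorem 4.1.1 (iii); lane plumbing] -/
theorem nil_seq_rec_Lam {y lam : ℝ} (hc : perronCubicTwo y lam = 0) (hd : dLam y lam ≠ 0) (hlam : lam ≠ 0)
    (X : Matrix (Fin (2 * 2)) (Fin (2 * 2)) ℝ) (a b : Fin (2 * 2)) (n : ℕ) :
    (nilLam y lam ^ (n + 2 + 1) * X) a b = -pLam y lam * (nilLam y lam ^ (n + 1 + 1) * X) a b - kLam y lam * (nilLam y lam ^ (n + 1) * X) a b := by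
  have hcub := nilLam_cubic hc hd hlam
  have hmat : (nilLam y lam ^ (n + 2 + 1) + pLam y lam • nilLam y lam ^ (n + 1 + 1) + kLam y lam • nilLam y lam ^ (n + 1)) * X = 0 := by
    rw [show nilLam y lam ^ (n + 2 + 1) = nilLam y lam ^ n * nilLam y lam ^ 3 by rw [← pow_add],
      show nilLam y lam ^ (n + 1 + 1) = nilLam y lam ^ n * nilLam y lam ^ 2 by rw [← pow_add],
      show nilLam y lam ^ (n + 1) = nilLam y lam ^ n * nilLam y lam by rw [pow_succ],
      ← Matrix.mul_smul, ← Matrix.mul_smul, ← Matrix.mul_add, ← Matrix.mul_add, hcub, Matrix.mul_zero, Matrix.zero_mul]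
  have h := congrFun (congrFun hmat a) b
  simp only [Matrix.add_mul, Matrix.smul_mul, Matrix.add_apply, Matrix.smul_apply, Matrix.zero_apply, smul_eq_mul] at h
  linarith

/-- The geometric rate of the deflated part at `(y, λ)`: `R(y, λ) = quadRootBound(p, κ)` (the modulus bound of the roots of `σ² + pσ + κ`, i.e. of the
two non-Perron nonzero eigenvalues of `G(y)`). [cite: Stanley2012EC1, §4.1; lane «pcv-sawmu» a-p2 g27] -/
def rateLam (y lam : ℝ) : ℝ := Literature.Analysis.quadRootBound (pLam y lam) (kLam y lam)

/-- ★★ **Deflation bound at a tilted fugacity**: on the Perron curve (`d ≠ 0`, `λ ≠ 0`), for every right factor `X`, all `a, b` and every `n`,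
`|(N^{n+2}·X)_{ab}| ≤ R^{n+1}|c₀| + (n+1)Rⁿ(|c₁| + R|c₀|)` with `c₀ = (N·X)_{ab}`, `c₁ = (N²·X)_{ab}`, `R = rateLam y λ` (a-p5's `abs_le_of_rec_two`).
[cite: Stanley2012EC1, §4.1 Theorem 4.1.1 (iii); lane «pcv-sawmu» a-p2 g27 — own] -/
theorem nilLam_pow_mul_abs_le {y lam : ℝ} (hc : perronCubicTwo y lam = 0) (hd : dLam y lam ≠ 0) (hlam : lam ≠ 0)
    (X : Matrix (Fin (2 * 2)) (Fin (2 * 2)) ℝ) (a b : Fin (2 * 2)) (n : ℕ) :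
    |(nilLam y lam ^ (n + 2) * X) a b| ≤
      rateLam y lam ^ (n + 1) * |(nilLam y lam * X) a b|
        + ((n : ℝ) + 1) * rateLam y lam ^ n * (|(nilLam y lam ^ 2 * X) a b| + rateLam y lam * |(nilLam y lam * X) a b|) := by
  set w : ℕ → ℝ := fun m => (nilLam y lam ^ (m + 1) * X) a b with hw
  have hrec : ∀ m, w (m + 2) = -pLam y lam * w (m + 1) - kLam y lam * w m := fun m => nil_seq_rec_Lam hc hd hlam X a b m
  have hR0 : 0 ≤ rateLam y lam := Literature.Analysis.quadRootBound_nonneg _ _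
  have hR : ∀ σ : ℂ, σ ^ 2 + (pLam y lam : ℂ) * σ + (kLam y lam : ℂ) = 0 → ‖σ‖ ≤ rateLam y lam :=
    fun σ hσ => Literature.Analysis.norm_le_quadRootBound hσ
  have h := Literature.Analysis.abs_le_of_rec_two hR0 hR hrec n
  have e0 : w 0 = (nilLam y lam * X) a b := by simp [hw]
  have e1 : w 1 = (nilLam y lam ^ 2 * X) a b := by simp [hw]
  have e2 : w (n + 1) = (nilLam y lam ^ (n + 2) * X) a b := by simp [hw]
  rw [e0, e1, e2] at h
  exact h

/-- ★★★ **THE TILTED HAT BRIDGE SUMS, DECOMPOSED**: for every `y ≥ 0` and `λ` on the Perron curve with `d(y, λ) ≠ 0`, `λ ≠ 0`, and every `k ≥ 1`,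
`D̂(k; y) = (λ^k/d)·(Π̃·P) + N^k·P` (`P = 1 + M̂(0)`) — the hat bridge sums at a tilted contact fugacity are an exact rank-one multiple of `λ^k` plus
a deflated part obeying the geometric bound `nilLam_pow_mul_abs_le`.  At `y = y₂`, `λ = 1` this is «WIDTH-TWO HAT CONVERGENCE»; for the tilts
`y = y(λ)` of «… CHERNOFF BOUNDS» it is the exact exponential growth `λ^k` that the moment generating function of the contact count inherits.
[cite: Seneta1973, §1.4; Feller1968, XIII.6, XIII.10; lane «pcv-sawmu» a-p2 g27 — own result, not in print] -/
theorem hatD_two_eq_Lam {y lam : ℝ} (hy : 0 ≤ y) (hc : perronCubicTwo y lam = 0) (hd : dLam y lam ≠ 0) {k : ℕ} (hk : 1 ≤ k) :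
    hatD 2 y k = (lam ^ k / dLam y lam) • (projNumLam y lam * (1 + hatMZeroTwo)) + nilLam y lam ^ k * (1 + hatMZeroTwo) := by
  obtain ⟨m, rfl⟩ : ∃ m, k = m + 1 := ⟨k - 1, by omega⟩
  rw [hatD_two_eq_pow_mul hy hk, gTwo_pow_eq_Lam hc hd m, Matrix.add_mul, Matrix.smul_mul]

/-! ## §3 The critical point `y = y₂`, `λ = 1`: consistency with «WIDTH-TWO HAT CONVERGENCE» -/

/-- At criticality `p(y₂, 1) = pTwo` and `κ(y₂, 1) = kTwo` (the subdominant quadratic of car «HAT CONVERGENCE»), hence `rateLam y₂ 1 = rTwo`.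
[cite: Stanley2012EC1, §4.1; lane plumbing] -/
theorem pLam_kLam_crit : pLam (stripYT 2) 1 = pTwo ∧ kLam (stripYT 2) 1 = kTwo ∧ rateLam (stripYT 2) 1 = rTwo := by
  have hP := xc_minpoly
  have hy := seven_mul_stripYT_two
  set x := hexCriticalFugacity with hx
  set y := stripYT 2 with hydef
  have h1 : pLam y 1 = pTwo := by
    rw [pLam, pTwo, ← hx]
    linear_combination ((8/7 : ℝ)) * hP + ((-1/7 : ℝ) * x ^ 2) * hy
  have h2 : kLam y 1 = kTwo := by
    rw [kLam, kTwo, ← hx]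
    linear_combination ((5/7 : ℝ) + (-8/7 : ℝ) * x ^ 2) * hP + ((-1/7 : ℝ) * x ^ 2 + (1/7 : ℝ) * x ^ 4) * hy
  exact ⟨h1, h2, by rw [rateLam, rTwo, h1, h2]⟩

/-- `d(y₂, 1) = (5/7 : ℝ) + (-2/7 : ℝ) * x ^ 2` (`≈ 0.63 > 0`). [cite: Seneta1973, §1.4; lane plumbing] -/
theorem dLam_crit : dLam (stripYT 2) 1 = (5/7 : ℝ) + (-2/7 : ℝ) * hexCriticalFugacity ^ 2 ∧ 0 < dLam (stripYT 2) 1 := by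
  have hP := xc_minpoly
  have hy := seven_mul_stripYT_two
  obtain ⟨hb1, hb2⟩ := xc_sq_bounds
  set x := hexCriticalFugacity with hx
  set y := stripYT 2 with hydef
  have h1 : dLam y 1 = (5/7 : ℝ) + (-2/7 : ℝ) * x ^ 2 := by
    rw [dLam]
    linear_combination ((2/7 : ℝ) + (-4/7 : ℝ) * x ^ 2 + (-13/7 : ℝ) * x ^ 4 + (8/7 : ℝ) * x ^ 6) * hP + ((2/7 : ℝ) * x ^ 6 + (-1/7 : ℝ) * x ^ 8) * hy
  refine ⟨h1, ?_⟩
  rw [h1]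
  nlinarith

/-- ★ Consistency: at criticality the unnormalised projection is `d(y₂,1)` times car «HAT CONVERGENCE»'s `projTwo` (`Π = Π̃/d`).
[cite: Seneta1973, §1.4; lane «pcv-sawmu» a-p2 g27] -/
theorem projNumLam_crit : projNumLam (stripYT 2) 1 = dLam (stripYT 2) 1 • projTwo := by
  have hP := xc_minpoly
  have hy := seven_mul_stripYT_two
  set x := hexCriticalFugacity with hx
  set y := stripYT 2 with hydef
  ext a b
  fin_cases a <;> fin_cases b <;> simp [projNumLam, Matrix.vecMulVec, uLam, wLam, dLam, projTwo, Matrix.smul_apply, ← hx]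
    <;> first
      | linear_combination
      | linear_combination ((1/2 : ℝ) + (3/2 : ℝ) * x ^ 4 + (9/7 : ℝ) * x ^ 6 + (-8/7 : ℝ) * x ^ 8) * hP + ((-1/7 : ℝ) * x ^ 6 + (-3/14 : ℝ) * x ^ 8 + (1/7 : ℝ) * x ^ 10) * hy
      | linear_combination ((-2 : ℝ) * x + (5/2 : ℝ) * x ^ 3 + (-201/14 : ℝ) * x ^ 7 + (52/7 : ℝ) * x ^ 9) * hP + ((-4/7 : ℝ) * x ^ 7 + (15/7 : ℝ) * x ^ 9 + (-13/14 : ℝ) * x ^ 11) * hy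
      | linear_combination ((-1 : ℝ) + (1 : ℝ) * x ^ 2 + (-1 : ℝ) * x ^ 4 + (-47/7 : ℝ) * x ^ 6 + (24/7 : ℝ) * x ^ 8) * hP + ((-1/7 : ℝ) * x ^ 6 + (1 : ℝ) * x ^ 8 + (-3/7 : ℝ) * x ^ 10) * hy
      | linear_combination ((-3/2 : ℝ) + (2 : ℝ) * x ^ 2 + (1/2 : ℝ) * x ^ 4 + (-64/7 : ℝ) * x ^ 6 + (32/7 : ℝ) * x ^ 8) * hP + ((-3/7 : ℝ) * x ^ 6 + (19/14 : ℝ) * x ^ 8 + (-4/7 : ℝ) * x ^ 10) * hy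
      | linear_combination ((1/2 : ℝ) + (-1 : ℝ) * x ^ 2 + (-1/2 : ℝ) * x ^ 4 + (38/7 : ℝ) * x ^ 6 + (-16/7 : ℝ) * x ^ 8) * hP + ((2/7 : ℝ) * x ^ 6 + (-11/14 : ℝ) * x ^ 8 + (2/7 : ℝ) * x ^ 10) * hy
      | linear_combination ((-1 : ℝ) * x + (12/7 : ℝ) * x ^ 3 + (13/7 : ℝ) * x ^ 5 + (-8/7 : ℝ) * x ^ 7) * hP + ((1/7 : ℝ) * x ^ 3 + (-1/7 : ℝ) * x ^ 5 + (-2/7 : ℝ) * x ^ 7 + (1/7 : ℝ) * x ^ 9) * hy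
      | linear_combination ((-3/2 : ℝ) + (2 : ℝ) * x ^ 2 + (-1/2 : ℝ) * x ^ 4 + (-85/7 : ℝ) * x ^ 6 + (40/7 : ℝ) * x ^ 8) * hP + ((-3/7 : ℝ) * x ^ 6 + (25/14 : ℝ) * x ^ 8 + (-5/7 : ℝ) * x ^ 10) * hy
      | linear_combination ((-1 : ℝ) * x + (5/7 : ℝ) * x ^ 5 + (-34/7 : ℝ) * x ^ 7 + (16/7 : ℝ) * x ^ 9) * hP + ((1/7 : ℝ) * x ^ 5 + (-2/7 : ℝ) * x ^ 7 + (5/7 : ℝ) * x ^ 9 + (-2/7 : ℝ) * x ^ 11) * hy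
      | linear_combination ((-3/2 : ℝ) * x + (2 : ℝ) * x ^ 3 + (-1/2 : ℝ) * x ^ 5 + (-85/7 : ℝ) * x ^ 7 + (40/7 : ℝ) * x ^ 9) * hP + ((-3/7 : ℝ) * x ^ 7 + (25/14 : ℝ) * x ^ 9 + (-5/7 : ℝ) * x ^ 11) * hy
      | linear_combination ((-1 : ℝ) * x ^ 2 + (12/7 : ℝ) * x ^ 4 + (13/7 : ℝ) * x ^ 6 + (-8/7 : ℝ) * x ^ 8) * hP + ((1/7 : ℝ) * x ^ 4 + (-1/7 : ℝ) * x ^ 6 + (-2/7 : ℝ) * x ^ 8 + (1/7 : ℝ) * x ^ 10) * hy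
      | linear_combination ((5/7 : ℝ) * x + (8/7 : ℝ) * x ^ 3 + (31/7 : ℝ) * x ^ 5 + (-50/7 : ℝ) * x ^ 7 + (16/7 : ℝ) * x ^ 9) * hP + ((1/7 : ℝ) * x + (-2/7 : ℝ) * x ^ 3 + (1/7 : ℝ) * x ^ 5 + (-6/7 : ℝ) * x ^ 7 + (1 : ℝ) * x ^ 9 + (-2/7 : ℝ) * x ^ 11) * hy

end W2

end HV

end Literature.Probability.RandomPlanarGeometry.SAW
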